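import Summits.HubbardSuperconductivity.HubbardSuperconductivity.Theorems.NodalDiracTwistTwistCalibrationBdGSpectrum
import Literature.MathematicalPhysics.QuantumLattice.HubbardHubbardModelEtaPairingProofs

/-!
# Route `NodalDiracTwist` — support `TwistCalibrationBdG`: the degeneracy locus (first clause)

Sixth helper file for stmt-HubbardSuperconductivity-1625: the zero-energy Bogoliubov modes and the
FIRST CLAUSE of `TwistCalibrationBdG`. `z_k(φ) = 0 ↔ cos(p₀ + φ₀/L) = cos(p₁ + φ₁/L) = -μ₀/4`
(`twistNambuZ_eq_zero_iff`); on the twist cell `(-π, π]` a shifted grid momentum hits `±κ` iff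
`|φ_μ| = c`, `cos c = cos(Lκ)` (`exists_cos_grid_eq_cos_iff`); non-resonance `Lκ ∉ πℤ` puts
`c = arccos(cos(Lκ))` in `(0, π)` (`arccos_cos_mem_Ioo`); and
**`exists_orthogonal_sector_ground_states_iff`**: in the cell, `H(φ)|_{ker S^z}` has two orthogonal
ground states iff `|φ₀| = |φ₁| = c` — the diagonal quartet `(±c, ±c)`, positions `= L × node`.

Sources: de Gennes (1966) Ch. 5; Karakuzu–Seki–Sorella (2018) Sec. II D. No definitions.
-/

-- the mandated namespace `Summit.<Summit>.<Problem>.Theorems` repeats `HubbardSuperconductivity`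
-- (single-problem summit, D-0017), which the `dupNamespace` linter flags on every declaration
set_option linter.dupNamespace false

namespace Summit.HubbardSuperconductivity.HubbardSuperconductivity.Theorems.NodalDiracTwist

open Matrix Finset Literature.Probability.LatticeModels Literature.MathematicalPhysics.QuantumLattice
open scoped ComplexConjugate

variable {d L : ℕ} [NeZero L]

/-! ### The zero-energy modes and the diagonal quartet of twists -/

section ZeroSet

omit [NeZero L] in
/-- **The nodes**: for `h ≠ 0`, `z_k(φ) = 0` iff `cos(p₀ + φ₀/L) = cos(p₁ + φ₁/L) = -μ₀/4` (both
`ξ_k = -2(cos q₀ + cos q₁) - μ₀` and `ĝ_k = 2(cos q₀ - cos q₁)` vanish). [folklore] -/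
theorem twistNambuZ_eq_zero_iff {μ₀ h : ℝ} (hh : h ≠ 0) (φ : Fin 2 → ℝ) (k : TorusSite 2 L) :
    twistNambuZ L μ₀ h φ k = 0 ↔
      Real.cos (latticeMomentum L k 0 + φ 0 / L) = -μ₀ / 4 ∧
        Real.cos (latticeMomentum L k 1 + φ 1 / L) = -μ₀ / 4 := by
  rw [twistNambuZ, Complex.ext_iff]
  simp only [Complex.add_re, Complex.ofReal_re, Complex.mul_re, Complex.I_re, mul_zero,
    Complex.ofReal_im, Complex.I_im, mul_one, sub_self, add_zero, Complex.zero_re, Complex.add_im,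
    Complex.mul_im, zero_add, Complex.zero_im, twistXi, twistPairSymbol, Fin.sum_univ_two,
    Fin.val_zero, pow_zero, one_mul, Fin.val_one, pow_one, neg_mul]
  constructor
  · rintro ⟨h1, h2⟩
    have h3 : Real.cos (latticeMomentum L k 0 + φ 0 / L) - Real.cos (latticeMomentum L k 1 + φ 1 / L) = 0 := by
      have := mul_eq_zero.mp h2
      rcases this with h4 | h4
      · exact absurd h4 hh
      · linarith
    constructor <;> linarith
  · rintro ⟨h1, h2⟩
    constructor
    · rw [h1, h2]; ring
    · rw [h1, h2]; ring

/-- One coordinate of the node condition on the twist cell: for `θ ∈ (-π, π]` and `c ∈ [0, π]` with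
`cos c = cos(Lκ)`, some shifted grid momentum `2πv/L + θ/L` (`v ∈ ℤ/Lℤ`) has `cos = cos κ` iff
`|θ| = c` (positions `= L × node` modulo `2π`). [folklore] -/
theorem exists_cos_grid_eq_cos_iff {κ c θ : ℝ} (hc0 : 0 ≤ c) (hcπ : c ≤ Real.pi)
    (hcos : Real.cos c = Real.cos (L * κ)) (hθ : θ ∈ Set.Ioc (-Real.pi) Real.pi) :
    (∃ v : ZMod L, Real.cos (2 * Real.pi * (v.val : ℝ) / L + θ / L) = Real.cos κ) ↔ |θ| = c := by
  have hL : (L : ℝ) ≠ 0 := Nat.cast_ne_zero.mpr (NeZero.ne L)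
  have hLpos : (0 : ℝ) < L := Nat.cast_pos.mpr (Nat.pos_of_ne_zero (NeZero.ne L))
  constructor
  · rintro ⟨v, hv⟩
    -- `cos θ = cos (Lκ)`
    have hθc : Real.cos θ = Real.cos (L * κ) := by
      rw [Real.cos_eq_cos_iff] at hv
      obtain ⟨j, hj | hj⟩ := hv
      · have : θ = L * κ + ((-(j * (L : ℤ) + (v.val : ℤ)) : ℤ) : ℝ) * (2 * Real.pi) := by
          rw [hj]
          push_cast
          field_simp
          ring
        rw [this, Real.cos_add_int_mul_two_pi]
      · have : θ = -(L * κ) + (((j * (L : ℤ) - (v.val : ℤ)) : ℤ) : ℝ) * (2 * Real.pi) := by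
          rw [hj]
          push_cast
          field_simp
          ring
        rw [this, Real.cos_add_int_mul_two_pi, Real.cos_neg]
    rw [← hcos, ← Real.cos_abs] at hθc
    exact Real.injOn_cos ⟨abs_nonneg θ, abs_le.mpr ⟨by linarith [hθ.1], hθ.2⟩⟩ ⟨hc0, hcπ⟩ hθc
  · intro hθc
    have h1 : Real.cos θ = Real.cos (L * κ) := by rw [← Real.cos_abs, hθc, hcos]
    rw [Real.cos_eq_cos_iff] at h1
    obtain ⟨m, hm | hm⟩ := h1
    · -- `Lκ = 2mπ + θ`: take `v = m`
      refine ⟨(m : ZMod L), ?_⟩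
      have hval : (((m : ZMod L).val : ℤ) : ℝ) = ((m % (L : ℤ) : ℤ) : ℝ) := by
        rw [ZMod.val_intCast]
      have hval' : ((m : ZMod L).val : ℝ) = (m : ℝ) - (L : ℝ) * ((m / (L : ℤ) : ℤ) : ℝ) := by
        have := hval
        rw [Int.emod_def] at this
        push_cast at this
        exact_mod_cast this
      have : 2 * Real.pi * ((m : ZMod L).val : ℝ) / L + θ / L =
          κ + ((-(m / (L : ℤ)) : ℤ) : ℝ) * (2 * Real.pi) := by
        rw [hval']
        push_cast
        field_simp
        linarith [hm]
      rw [this, Real.cos_add_int_mul_two_pi]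
    · -- `Lκ = 2mπ - θ`: take `v = -m`
      refine ⟨((-m : ℤ) : ZMod L), ?_⟩
      have hval : ((((-m : ℤ) : ZMod L).val : ℤ) : ℝ) = (((-m) % (L : ℤ) : ℤ) : ℝ) := by
        rw [ZMod.val_intCast]
      have hval' : (((-m : ℤ) : ZMod L).val : ℝ) = -(m : ℝ) - (L : ℝ) * (((-m) / (L : ℤ) : ℤ) : ℝ) := by
        have := hval
        rw [Int.emod_def] at this
        push_cast at this
        exact_mod_cast this
      have : 2 * Real.pi * (((-m : ℤ) : ZMod L).val : ℝ) / L + θ / L =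
          -κ + ((-((-m) / (L : ℤ)) : ℤ) : ℝ) * (2 * Real.pi) := by
        rw [hval']
        push_cast
        field_simp
        linarith [hm]
      rw [this, Real.cos_add_int_mul_two_pi, Real.cos_neg]

/-- **The degeneracy locus is the diagonal quartet.** For `μ₀ ∈ (-4, 4)`, `h ≠ 0`, `c ∈ [0, π]` with
`cos c = cos(L arccos(-μ₀/4))` and a twist `φ` in the cell `(-π, π]²`: some Bogoliubov mode has zero
energy iff `|φ₀| = |φ₁| = c`. [folklore] -/
theorem exists_twistNambuZ_eq_zero_iff {μ₀ h : ℝ} (hμ₁ : -4 < μ₀) (hμ₂ : μ₀ < 4) (hh : h ≠ 0)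
    {c : ℝ} (hc0 : 0 ≤ c) (hcπ : c ≤ Real.pi)
    (hcos : Real.cos c = Real.cos (L * Real.arccos (-μ₀ / 4))) {φ : Fin 2 → ℝ}
    (hφ0 : φ 0 ∈ Set.Ioc (-Real.pi) Real.pi) (hφ1 : φ 1 ∈ Set.Ioc (-Real.pi) Real.pi) :
    (∃ k : TorusSite 2 L, twistNambuZ L μ₀ h φ k = 0) ↔ (|φ 0| = c ∧ |φ 1| = c) := by
  have hκ : -μ₀ / 4 = Real.cos (Real.arccos (-μ₀ / 4)) :=
    (Real.cos_arccos (by linarith) (by linarith)).symm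
  simp only [twistNambuZ_eq_zero_iff hh, latticeMomentum]
  rw [hκ, ← exists_cos_grid_eq_cos_iff hc0 hcπ hcos hφ0, ← exists_cos_grid_eq_cos_iff hc0 hcπ hcos hφ1]
  constructor
  · rintro ⟨k, hk0, hk1⟩
    exact ⟨⟨k 0, hk0⟩, ⟨k 1, hk1⟩⟩
  · rintro ⟨⟨v₀, hv₀⟩, ⟨v₁, hv₁⟩⟩
    refine ⟨![v₀, v₁], ?_, ?_⟩
    · simpa using hv₀
    · simpa using hv₁

omit [NeZero L] in
/-- **Non-resonance.** If `Lκ ∉ πℤ` then `c = arccos(cos(Lκ))` lies in the OPEN interval `(0, π)`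
(and `cos c = cos(Lκ)`). [folklore] -/
theorem arccos_cos_mem_Ioo {κ : ℝ} (hres : ∀ m : ℤ, (L : ℝ) * κ ≠ m * Real.pi) :
    0 < Real.arccos (Real.cos (L * κ)) ∧ Real.arccos (Real.cos (L * κ)) < Real.pi ∧
      Real.cos (Real.arccos (Real.cos (L * κ))) = Real.cos (L * κ) := by
  refine ⟨?_, ?_, Real.cos_arccos (Real.neg_one_le_cos _) (Real.cos_le_one _)⟩
  · rw [Real.arccos_pos]
    refine lt_of_le_of_ne (Real.cos_le_one _) fun h1 => ?_
    obtain ⟨n, hn⟩ := (Real.cos_eq_one_iff _).mp h1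
    exact hres (2 * n) (by push_cast; linarith)
  · rw [Real.arccos_lt_pi]
    refine lt_of_le_of_ne (Real.neg_one_le_cos _) fun h1 => ?_
    obtain ⟨n, hn⟩ := Real.cos_eq_neg_one_iff.mp h1.symm
    exact hres (2 * n + 1) (by push_cast; linarith)

end ZeroSet

section PartA

/-- A vector of unit norm is nonzero. [folklore] -/
theorem ne_zero_of_star_dotProduct_self_eq_one {ι : Type*} [Fintype ι] {x : ι → ℂ}
    (hx : star x ⬝ᵥ x = 1) : x ≠ 0 := by
  rintro rfl
  rw [star_zero, dotProduct_zero] at hx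
  exact zero_ne_one hx

/-- **Exact positions of the ground-state degeneracies (`TwistCalibrationBdG`, first clause).**
For `μ₀ ∈ (-4, 4)`, `h ≠ 0` and `c ∈ [0, π]` with `cos c = cos(L arccos(-μ₀/4))`: at a twist `φ` of
the cell `(-π, π]²`, the `U = 0` sourced spin-twisted family restricted to `ker S^z` has two
orthogonal ground states iff `|φ₀| = |φ₁| = c` (the diagonal quartet `(±c, ±c)`); elsewhere its
sector ground state is unique. de Gennes (1966) Ch. 5 (BdG spectrum); the locus is `L ×` (nodes of
the `d`-wave quasiparticle dispersion) `mod 2π`. [folklore] -/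
theorem exists_orthogonal_sector_ground_states_iff {μ₀ h : ℝ} (hμ₁ : -4 < μ₀) (hμ₂ : μ₀ < 4)
    (hh : h ≠ 0) {c : ℝ} (hc0 : 0 ≤ c) (hcπ : c ≤ Real.pi)
    (hcos : Real.cos c = Real.cos (L * Real.arccos (-μ₀ / 4))) {φ : Fin 2 → ℝ}
    (hφ0 : φ 0 ∈ Set.Ioc (-Real.pi) Real.pi) (hφ1 : φ 1 ∈ Set.Ioc (-Real.pi) Real.pi) :
    let K := LinearMap.ker (Matrix.toLin' (HubbardWave0.spinZ :
      Matrix (Finset (Orb (FermionTorus 2 L))) (Finset (Orb (FermionTorus 2 L))) ℂ))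
    let H := sourcedSpinTwistedHubbardTorus L 0 μ₀ h φ
    (∃ ψ₁ ψ₂ : Fock (Orb (FermionTorus 2 L)),
      (ψ₁ ∈ K ∧ ψ₁ ≠ 0 ∧ H *ᵥ ψ₁ = ((H.minEnergyOn K : ℝ) : ℂ) • ψ₁) ∧
      (ψ₂ ∈ K ∧ ψ₂ ≠ 0 ∧ H *ᵥ ψ₂ = ((H.minEnergyOn K : ℝ) : ℂ) • ψ₂) ∧ star ψ₁ ⬝ᵥ ψ₂ = 0) ↔
    (|φ 0| = c ∧ |φ 1| = c) := by
  intro K H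
  simp only [K, H, minEnergyOn_sourcedSpinTwisted_ker_spinZ, LinearMap.mem_ker, Matrix.toLin'_apply]
  rw [← exists_twistNambuZ_eq_zero_iff hμ₁ hμ₂ hh hc0 hcπ hcos hφ0 hφ1]
  constructor
  · rintro ⟨ψ₁, ψ₂, ⟨-, h1ne, h1H⟩, ⟨-, h2ne, h2H⟩, horth⟩
    by_contra hk
    push Not at hk
    have hz : ∀ x : FermionTorus 2 L, twistNambuZ L μ₀ h φ x.toTorusSite ≠ 0 := fun x => hk _
    have e1 := eq_smul_bcs_of_forall_twistNambuZ_ne_zero hz h1H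
    have e2 := eq_smul_bcs_of_forall_twistNambuZ_ne_zero hz h2H
    rw [e1, e2, star_smul_dotProduct_smul, star_bdgV_conjTranspose_single_dotProduct, if_pos rfl, mul_one,
      mul_eq_zero, star_eq_zero] at horth
    rcases horth with h0 | h0
    · exact h1ne (by rw [e1, h0, zero_smul])
    · exact h2ne (by rw [e2, h0, zero_smul])
  · rintro ⟨k, hk⟩
    have hx : twistNambuZ L μ₀ h φ (FermionTorus.ofTorusSite k).toTorusSite = 0 := by
      rwa [FermionTorus.toTorusSite_ofTorusSite]
    obtain ⟨ψ₁, ψ₂, ⟨h1S, h1n, h1H⟩, ⟨h2S, h2n, h2H⟩, horth⟩ :=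
      exists_orthogonal_ground_states_of_twistNambuZ_eq_zero (L := L) _ hx
    exact ⟨ψ₁, ψ₂, ⟨h1S, ne_zero_of_star_dotProduct_self_eq_one h1n, h1H⟩,
      ⟨h2S, ne_zero_of_star_dotProduct_self_eq_one h2n, h2H⟩, horth⟩

end PartA

end Summit.HubbardSuperconductivity.HubbardSuperconductivity.Theorems.NodalDiracTwist
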